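import Summits.BirchSwinnertonDyer.BirchSwinnertonDyer.Theorems.GenusKolyvaginAtTwoMinimalTwinBSDTwoSwappedPairFrame
import Summits.BirchSwinnertonDyer.BirchSwinnertonDyer.Theorems.GenusKolyvaginAtTwoShaCardDvdPowAtTwoPosTOnCutRankQ
import Summits.BirchSwinnertonDyer.Uniform.U2.RingClassNoTwoTorsion
import Summits.BirchSwinnertonDyer.Rank1Residual.X11b.Three.KolyvaginLine
import Summits.BirchSwinnertonDyer.BirchSwinnertonDyer.Theorems.GenusKolyvaginAtTwoGenusDeepSupplyAtTwoNegDiscNarrowDepthZeroInstance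
import HarnessLib

/-!
# Route `GenusKolyvaginAtTwo`, crux U₂ `MinimalTwinBSDTwo` (stmt-BirchSwinnertonDyer-22985), LINE 23 «twin_swap»:
# THE RATIONAL HEEGNER POINT for `w(E) = −1` and the `ℚ`-side reading of S2′'s `2`-primitivity clause «`P(1) ∉ 2E(K[1])`»

Width seat `bsd-line-gk2-p4` g26 (cell `bsd-f1-sign2`), `--supports stmt-BirchSwinnertonDyer-22985` (helper; closes nothing).
THEOREMS ONLY (no definition, no named fact, no `sorry`); **BSD is NOT proved by any of this; U₂ / hTw is NOT proved; nothing is closed.**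

CONTEXT.  On LINE 23's budget slice (stub S3′ `TwinSwap.swappedPairDescentAtTwo_depthZero_of_facts`, gk2-p2 g23: the rank-ONE member `E` with
`#Sel₂(E) = 2`, `C(E)` odd, a Heegner field `K` with odd `d_K`, a conductor-`1` datum `d₁` with `P(1)` of infinite order, a `2`-Selmer-TRIVIAL
twin `Wd ≅ E^(d_K)` inside the genus budget) the one beyond-print clause of the supply stub S2′ is «`P(1) ∉ 2E(K[1])`» (forced by `BSD₂(E) ∧
BSD₂(Wd)` modulo print, g23's `…SwappedPairLossless`).  Here `w(E) = −1`, so Darmon 3.11 / Gross 5.3 makes `y_K` RATIONAL up to odd torsion;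
this file builds that rational point and reads the clause on it in Kummer-class currency — the sequel `…SwappedPairLocalBit` turns it into ONE
LOCAL BIT (the LINE-23 twin of the Δ<0 supply cell's reduction bit R₁, `DepthZero.K1_iff_reductionBit`).  CONVENTION (tree `QuadraticTwistRank`
design note): point-group algebra over the base field is done in the GENERIC §1 (instantiated at `F = ℚ`), and `ℚ`-side divisibility is carried
as `κ₂(Y) = 0` (`kummerMapTorsion`), so that one `DecidableEq ℚ` instance is in play.

* §1 (generic quadratic `L/F`) `exists_incl_eq_add_two_smul_of_isOfFinAddOrder` — `σP₀ − P₀` torsion and `V(L)[2] = 0` ⟹ `ι Y = P₀ + 2u` for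
  some `Y ∈ V(F)`, `u` torsion (`t₀ = σP₀ − P₀` has odd order, `Y = P₀ + ½t₀` is `σ`-fixed); `exists_two_smul_iff_of_incl_eq` — then
  `P₀ ∈ 2V(L) ⟺ Y ∈ 2V(F)`; `kummerMapTorsion_eq_zero_iff_exists_smul` — `κ_n(Y) = 0 ⟺ Y ∈ nV(F)`.
* §2 (`E/ℚ`, `w(E) = −1`) `exists_rational_heegnerPoint_of_rootNumber_eq_neg_one` — the Heegner point `P₀ ∈ E(K)` under `P(1)` has `ι Y = P₀ + 2u`
  with `Y ∈ E(ℚ)`, `u` torsion; **`exists_two_smul_derivedPoint_iff_kummer_eq_zero`** — `P(1) ∈ 2E(K[1]) ⟺ κ₂(Y) = 0` (McCallum 5.1 + §1).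
* §3 frame bookkeeping on S3′: `noTwoTorsion_of_frame` (`E(ℚ)[2] = 0`), `rootNumber_eq_neg_one_of_analyticRank_eq_one` (`w(E) = −1`).

References: [GrossLMS1991] §5 Prop. 5.3, §4 (4.1); [Darmon2004] Prop. 3.11, §3.9; [McCallumLMS1991] §5 Lemma 5.1; [SilvermanAEC2009] VIII §2,
X.4.2, Exercise 10.16.
-/

set_option autoImplicit false
set_option linter.dupNamespace false -- `Summit.<P>.<Sub>` repeats `BirchSwinnertonDyer` (D-0017)

noncomputable section

open scoped Classical NumberField

namespace Summit.BirchSwinnertonDyer.BirchSwinnertonDyer.Theorems.GenusExact.TwinSwapBit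

open IsDedekindDomain Field NumberField WeierstrassCurve Literature.NumberTheory.EllipticCurves
  Literature.NumberTheory.EllipticCurves.ModularForms Literature.NumberTheory.GaloisRepresentations Rat.HeightOneSpectrum
open Summit.BirchSwinnertonDyer.BirchSwinnertonDyer.Theorems.GenusExact.PlusDescent
open Summit.BirchSwinnertonDyer.BirchSwinnertonDyer.Theorems.GenusExact.TwinSwap
open Summit.BirchSwinnertonDyer.BirchSwinnertonDyer.Theorems.GenusKolyArch (hdiv_two localization_kummerMapTorsion_eq_zero_iff
  natCard_ker_nsmul_eq_of_intertwining forall_sq_ne_completion_of_neg embedding_of_isReal_rat_apply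
  natCard_selmerGroup_twist_eq_mul_two_of_menu₅_inl)
open Summit.BirchSwinnertonDyer.BirchSwinnertonDyer.Theorems.GenusKolyTwistLocal (natCard_ker_nsmul_adicCompletion_eq_padic
  exists_intertwining_master_frame exists_selmer_localization_ne_zero_of_not_le_strictLocalKer)
open Summit.BirchSwinnertonDyer.BirchSwinnertonDyer.Theorems.GenusSupplyNarrow.DepthZero (odd_addOrderOf_of_two_torsionFree)
open Summit.BirchSwinnertonDyer.Rank1Residual.X11b.Three (Koly.pDiv_one_iff_exists_zsmul_eq Koly.PDiv)

/-! ## §1 Generic quadratic descent `K/F`: the `σ`-fixed half of a point with torsion `σ`-defect -/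

section Generic

variable {F : Type} {L : Type} [Field F] [Field L] [Algebra F L] [NeZero (2 : F)]

/-- **`ι Y = P₀ + 2u` with `Y` rational over the base.**  `L/F` quadratic (`2 ≠ 0`), `σ ≠ 1` an `F`-endomorphism of `L`, `V/F`,
`V(L)[2] = 0`, `P₀ ∈ V(L)` with `σP₀ − P₀` of finite order.  Then `t₀ = σP₀ − P₀` has ODD order `m` and is `σ`-anti-invariant,
`s₀ = ((m+1)/2)·t₀` satisfies `2s₀ = t₀`, `σs₀ = −s₀`, and `P₀ + s₀` is `σ`-fixed, hence `= ι Y` for some `Y ∈ V(F)` (Galois descent);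
`u = ((m+1)/2)·s₀` has `2u = s₀`.  [cite: SilvermanAEC2009, X, Exercise 10.16] [cite: Darmon2004, §3.9 (proof of Thm. 3.22)] -/
theorem exists_incl_eq_add_two_smul_of_isOfFinAddOrder (h2 : Module.finrank F L = 2) (V : WeierstrassCurve F)
    {σ : L →ₐ[F] L} (hσ : σ ≠ AlgHom.id F L)
    (h2L : ∀ T : (V.baseChange L).toAffine.Point, (2 : ℤ) • T = 0 → T = 0)
    {P₀ : (V.baseChange L).toAffine.Point} (ht : IsOfFinAddOrder (QuadraticDescent.conjMap V σ P₀ - P₀)) :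
    ∃ (Y : V.toAffine.Point) (u : (V.baseChange L).toAffine.Point),
      IsOfFinAddOrder u ∧ QuadraticDescent.incl L V Y = P₀ + (2 : ℤ) • u := by
  have hσσ : ∀ z, σ (σ z) = z := Literature.NumberTheory.EllipticCurves.Quadratic.apply_apply_of_ne_id h2 hσ
  set t₀ : (V.baseChange L).toAffine.Point := QuadraticDescent.conjMap V σ P₀ - P₀ with ht₀
  have hσt₀ : QuadraticDescent.conjMap V σ t₀ = -t₀ := by
    rw [ht₀, map_sub, QuadraticDescent.conjMap_conjMap V hσσ]
    abel
  -- `t₀` has odd order `m`; `s₀ = ((m+1)/2)·t₀`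
  have hodd : Odd (addOrderOf t₀) := odd_addOrderOf_of_two_torsionFree ht fun k hk ↦ h2L _ hk
  obtain ⟨m', hm'⟩ := hodd
  set c : ℤ := (m' : ℤ) + 1 with hc
  set s₀ : (V.baseChange L).toAffine.Point := c • t₀ with hs₀
  have h2s₀ : (2 : ℤ) • s₀ = t₀ := by
    have hcm : (2 : ℤ) * c = (addOrderOf t₀ : ℤ) + 1 := by rw [hc, hm']; push_cast; ring
    rw [hs₀, smul_smul, hcm, add_zsmul, one_zsmul, natCast_zsmul, addOrderOf_nsmul_eq_zero, zero_add]
  have hσs₀ : QuadraticDescent.conjMap V σ s₀ = -s₀ := by rw [hs₀, map_zsmul, hσt₀, zsmul_neg]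
  -- `P₀ + s₀` is `σ`-fixed, hence rational over `F`
  have hfix : QuadraticDescent.conjMap V σ (P₀ + s₀) = P₀ + s₀ := by
    have hσP : QuadraticDescent.conjMap V σ P₀ = P₀ + t₀ := by rw [ht₀]; abel
    rw [map_add, hσs₀, hσP, ← h2s₀, two_zsmul]
    abel
  obtain ⟨Y, hY⟩ := QuadraticDescent.exists_incl_eq_of_conjMap_eq h2 V hσ hfix
  refine ⟨Y, c • s₀, ht.zsmul.zsmul, ?_⟩
  have : (2 : ℤ) • (c • s₀) = s₀ := by rw [smul_comm, h2s₀]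
  rw [this]
  exact hY

/-- **`P₀ ∈ 2V(L) ⟺ Y ∈ 2V(F)`** when `ι Y = P₀ + 2u` (`L/F` quadratic, `σ ≠ 1`, `V(L)[2] = 0`): a half `Q` of `P₀` gives the half `Q + u` of
`ι Y`, which is `σ`-fixed (its `σ`-translate differs by `2`-torsion) and descends; conversely `ι Q₀ − u` halves `P₀`.
[cite: SilvermanAEC2009, X, Exercise 10.16] -/
theorem exists_two_smul_iff_of_incl_eq (h2 : Module.finrank F L = 2) (V : WeierstrassCurve F)
    {σ : L →ₐ[F] L} (hσ : σ ≠ AlgHom.id F L)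
    (h2L : ∀ T : (V.baseChange L).toAffine.Point, (2 : ℤ) • T = 0 → T = 0)
    {P₀ u : (V.baseChange L).toAffine.Point} {Y : V.toAffine.Point}
    (hY : QuadraticDescent.incl L V Y = P₀ + (2 : ℤ) • u) :
    (∃ Q : (V.baseChange L).toAffine.Point, (2 : ℤ) • Q = P₀) ↔ ∃ Q₀ : V.toAffine.Point, (2 : ℤ) • Q₀ = Y := by
  constructor
  · rintro ⟨Q, hQ⟩
    set R : (V.baseChange L).toAffine.Point := Q + u with hR
    have hYR : QuadraticDescent.incl L V Y = (2 : ℤ) • R := by rw [hY, hR, zsmul_add, hQ]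
    have hRfix : QuadraticDescent.conjMap V σ R = R := by
      have h0 : (2 : ℤ) • (QuadraticDescent.conjMap V σ R - R) = 0 := by
        rw [zsmul_sub, ← map_zsmul, ← hYR, QuadraticDescent.conjMap_incl, sub_self]
      exact sub_eq_zero.mp (h2L _ h0)
    obtain ⟨Q₀, hQ₀⟩ := QuadraticDescent.exists_incl_eq_of_conjMap_eq h2 V hσ hRfix
    refine ⟨Q₀, QuadraticDescent.incl_injective (K := L) V ?_⟩
    rw [map_zsmul, hQ₀, hYR]
  · rintro ⟨Q₀, hQ₀⟩
    refine ⟨QuadraticDescent.incl L V Q₀ - u, ?_⟩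
    rw [zsmul_sub, ← map_zsmul, hQ₀, hY]
    abel

omit [NeZero (2 : F)] in
/-- **`κ_n(Y) = 0 ⟺ Y ∈ nV(F)`** (exactness of the Kummer sequence at `V(F)/n`, tree `kummerMapTorsion_ker`). [cite: SilvermanAEC2009, VIII §2] -/
theorem kummerMapTorsion_eq_zero_iff_exists_smul [PerfectField F] (V : WeierstrassCurve F) {n : ℤ}
    (hdiv : ∀ P : geomPoints V, ∃ Q : geomPoints V, n • Q = P) (Y : V.toAffine.Point) :
    kummerMapTorsion V n hdiv Y = 0 ↔ ∃ Q₀ : V.toAffine.Point, n • Q₀ = Y := by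
  have h := SetLike.ext_iff.mp (kummerMapTorsion_ker V n hdiv) Y
  rw [AddMonoidHom.mem_ker, AddMonoidHom.mem_range] at h
  exact h

end Generic

/-! ## §2 `E/ℚ` with `w(E) = −1`: the rational Heegner point and the `ℚ`-side reading of «`P(1) ∈ 2E(K[1])`» -/

variable (W : WeierstrassCurve ℚ) [W.IsElliptic] [W.IsGloballyMinimal] {K : Type} [Field K] [NumberField K]

/-- **The RATIONAL Heegner point for `w(E) = −1`.**  `E/ℚ` globally minimal of conductor `N`, `K` imaginary quadratic with the Heegner
hypothesis, `E(K)[2] = 0`, `w(E) = −1`; `d₁` a conductor-`1` Kolyvagin–Heegner datum.  Then the Heegner point `P₀ ∈ E(K)` under `P(1)`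
(Gross §4: `P(1) = y_K`) has `ι Y = P₀ + 2u` for a RATIONAL `Y ∈ E(ℚ)` and a torsion `u ∈ E(K)` (Darmon Prop. 3.11 with sign `−1`:
`τP₀ − P₀` is torsion; §1).  [cite: GrossLMS1991, §5 Prop. 5.3, §4 (4.1)] [cite: Darmon2004, Prop. 3.11, §3.9] -/
theorem exists_rational_heegnerPoint_of_rootNumber_eq_neg_one [NeZero (W.conductorNorm ℤ)] (hK : IsImaginaryQuadratic K)
    (hH : SatisfiesHeegnerHypothesis (W.conductorNorm ℤ) K) (hw : W.rootNumber = -1)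
    (h2K : ∀ T : (W.baseChange K).toAffine.Point, (2 : ℤ) • T = 0 → T = 0)
    (Dt : ModularParametrizationData W (W.conductorNorm ℤ)) (β : ℤ) (ι : K →+* ℂ) (d₁ : KolyvaginHeegnerData Dt β ι 1) :
    ∃ (P₀ : (W.baseChange K).toAffine.Point) (Y : W.toAffine.Point) (u : (W.baseChange K).toAffine.Point),
      Affine.Point.map (W' := W) (algebraMap K (ringClassField K ι 1)).toRatAlgHom P₀ = d₁.derivedPoint ∧
      IsOfFinAddOrder u ∧ QuadraticDescent.incl K W Y = P₀ + (2 : ℤ) • u := by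
  have h2 : Module.finrank ℚ K = 2 := hK.1
  -- `P₀ ∈ E(K)` over `P(1)`: a Heegner point
  obtain ⟨P₀, hP₀H, hP₀⟩ := heegnerSystem_exists_isHeegnerPoint_map_eq_derivedPoint_one
    (heegnerPointOfConductor_one_galoisConj_holds (W.conductorNorm ℤ) W K) hK hH d₁
  -- the non-trivial automorphism `τ`; Darmon 3.11 with `w = −1`: `τP₀ − P₀` is torsion
  obtain ⟨τ, hτ1, -⟩ := exists_conj_of_isImaginaryQuadratic (K := K) hK
  have hσ : (τ : K →ₐ[ℚ] K) ≠ AlgHom.id ℚ K := fun h ↦ hτ1 (AlgEquiv.ext fun x ↦ DFunLike.congr_fun h x)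
  have ht : IsOfFinAddOrder (QuadraticDescent.conjMap W (τ : K →ₐ[ℚ] K) P₀ - P₀) := by
    have h := heegnerPoint_conj_add_rootNumber_smul.apply heegnerPoint_conj_add_rootNumber_smul_holds hK hH hP₀H hσ
    rw [hw, neg_one_zsmul, ← sub_eq_add_neg] at h
    exact h
  obtain ⟨Y, u, hu, hY⟩ := exists_incl_eq_add_two_smul_of_isOfFinAddOrder h2 W hσ h2K ht
  exact ⟨P₀, Y, u, hP₀, hu, hY⟩

/-- **`P(1) ∈ 2E(K[1]) ⟺ κ₂(Y) = 0`** for the rational Heegner point `Y` of `exists_rational_heegnerPoint_of_rootNumber_eq_neg_one`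
(`ι Y = P₀ + 2u`, `u` torsion, `P₀ ↦ P(1)`), given `E(ℚ)[2] = 0` and a Heegner field of odd `d_K` (then `E(K)[2] = E(K[1])[2] = 0`):
McCallum 5.1's descent `K[1] → K` (`Koly.pDiv_one_iff_exists_zsmul_eq`), the descent `K → ℚ` of §1, and the Kummer sequence over `ℚ`.
[cite: McCallumLMS1991, §5 Lemma 5.1] [cite: GrossLMS1991, §4 Lemma 4.3] [cite: SilvermanAEC2009, VIII §2, X Exercise 10.16] -/
theorem exists_two_smul_derivedPoint_iff_kummer_eq_zero [NeZero (W.conductorNorm ℤ)] (hK : IsImaginaryQuadratic K)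
    (hodd : Odd (NumberField.discr K)) (hH : SatisfiesHeegnerHypothesis (W.conductorNorm ℤ) K)
    (hT2 : ∀ P : W.toAffine.Point, 2 • P = 0 → P = 0)
    (Dt : ModularParametrizationData W (W.conductorNorm ℤ)) (β : ℤ) (ι : K →+* ℂ) (d₁ : KolyvaginHeegnerData Dt β ι 1)
    {P₀ : (W.baseChange K).toAffine.Point} {Y : W.toAffine.Point} {u : (W.baseChange K).toAffine.Point}
    (hP₀ : Affine.Point.map (W' := W) (algebraMap K (ringClassField K ι 1)).toRatAlgHom P₀ = d₁.derivedPoint)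
    (hY : QuadraticDescent.incl K W Y = P₀ + (2 : ℤ) • u) :
    (∃ Q : (W.baseChange (ringClassField K ι 1)).toAffine.Point, (2 : ℤ) • Q = d₁.derivedPoint) ↔
      kummerMapTorsion W ((2 : ℕ) : ℤ) (hdiv_two W) Y = 0 := by
  have h2 : Module.finrank ℚ K = 2 := hK.1
  -- no `2`-torsion over `K[1]` (Gross 4.3 at `2` for a Heegner field of odd `d_K`, tree `Uniform.U2.RingClass`) and over `K`
  have hD4 : NumberField.discr K % 4 = 1 := Literature.NumberTheory.QuadraticFields.Quadratic.discr_emod_four_eq_one hK.1 hodd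
  haveI : NumberField (ringClassField K ι 1) := numberField_ringClassField hK ι one_ne_zero
  have htor1 : ∀ R : (W.baseChange (ringClassField K ι 1)).toAffine.Point, ((2 ^ 1 : ℕ) : ℤ) • R = 0 → R = 0 := fun R hR ↦
    Summit.BirchSwinnertonDyer.Uniform.U2.RingClass.forall_two_nsmul_eq_zero_of_heegner W hK ι hD4 hH
      (fun P hP ↦ by convert hT2 P (by convert hP)) one_ne_zero R (by rw [pow_one, natCast_zsmul] at hR; exact hR)
  have h2K : ∀ x : (W.baseChange K).toAffine.Point, (2 : ℤ) • x = 0 → x = 0 := fun x hx ↦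
    forall_two_zsmul_baseChange_eq_zero_of_heegner W K hK hodd hH hT2 x hx
  -- McCallum 5.1: `2 ∣ P(1)` in `E(K[1])` iff `2 ∣ P₀` in `E(K)`
  have hKK := Koly.pDiv_one_iff_exists_zsmul_eq hK d₁ P₀ hP₀ 2 1 htor1
  simp only [Koly.PDiv, pow_one, Nat.cast_ofNat] at hKK
  -- `K → ℚ` (§1) and the Kummer sequence over `ℚ`
  obtain ⟨τ, hτ1, -⟩ := exists_conj_of_isImaginaryQuadratic (K := K) hK
  have hσ : (τ : K →ₐ[ℚ] K) ≠ AlgHom.id ℚ K := fun h ↦ hτ1 (AlgEquiv.ext fun x ↦ DFunLike.congr_fun h x)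
  have hQY := exists_two_smul_iff_of_incl_eq h2 W hσ h2K hY
  have hκ := kummerMapTorsion_eq_zero_iff_exists_smul W (hdiv_two W) Y
  simp only [Nat.cast_ofNat] at hκ
  exact hKK.trans (hQY.trans hκ.symm)

/-! ## §3 Frame bookkeeping on S3′ -/

omit [W.IsGloballyMinimal] in
/-- `E(ℚ)[2] = 0` on the S3′ frame (`#Sel₂(E) = 2`, `#Sel₂(Wd) = 1`, `P(1)` of infinite order): `rank E^(d_K)(ℚ) = 0`, `rank E(K) ≥ 1`, so
`rank E(ℚ) ≥ 1` and the `2`-descent count forces `E(ℚ)[2] = 0` (gk2-p2's frame lemmas). [cite: SilvermanAEC2009, Thm. X.4.2, Exercise 10.16] -/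
theorem noTwoTorsion_of_frame [NeZero (W.conductorNorm ℤ)] (hSel : Nat.card (W.selmerGroup 2) = 2) (hK : IsImaginaryQuadratic K)
    (hH : SatisfiesHeegnerHypothesis (W.conductorNorm ℤ) K)
    (Dt : ModularParametrizationData W (W.conductorNorm ℤ)) (β : ℤ) (ι : K →+* ℂ) (d₁ : KolyvaginHeegnerData Dt β ι 1)
    (hy : ¬ IsOfFinAddOrder d₁.derivedPoint)
    {Wd : WeierstrassCurve ℚ} [Wd.IsElliptic] (Cd : VariableChange ℚ) (hCd : Cd • W.quadraticTwist (NumberField.discr K : ℚ) = Wd)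
    (hSel1 : Nat.card (Wd.selmerGroup 2) = 1) :
    ∀ P : W.toAffine.Point, 2 • P = 0 → P = 0 := by
  haveI : Module.Finite ℤ (W.baseChange K).toAffine.Point := (W.baseChange K).module_finite_point_holds
  obtain ⟨P₀, -, hP₀⟩ := heegnerSystem_exists_isHeegnerPoint_map_eq_derivedPoint_one
    (heegnerPointOfConductor_one_galoisConj_holds (W.conductorNorm ℤ) W K) hK hH d₁
  have hPinf : ¬ IsOfFinAddOrder P₀ := fun hfin ↦ hy (by
    rw [← hP₀]
    exact (Affine.Point.map (W' := W) (algebraMap K (ringClassField K ι 1)).toRatAlgHom).isOfFinAddOrder hfin)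
  have hK1 : 1 ≤ (W.baseChange K).mordellWeilRank :=
    Literature.NumberTheory.EllipticCurves.one_le_mordellWeilRank_of_not_isOfFinAddOrder (W.baseChange K) inferInstance hPinf
  have hd0 : (NumberField.discr K : ℚ) ≠ 0 := by exact_mod_cast (IsImaginaryQuadratic.discr_neg hK).ne
  haveI := W.isElliptic_quadraticTwist hd0
  have hSelT : Nat.card ((W.quadraticTwist (NumberField.discr K : ℚ)).selmerGroup ((2 : ℕ) : ℤ)) = 1 := by
    have h := natCard_selmerGroup_smul (W.quadraticTwist (NumberField.discr K : ℚ)) Cd (n := 2) two_ne_zero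
    rw [hCd] at h
    rw [← h, Nat.cast_ofNat]
    exact hSel1
  obtain ⟨hrkT0, -, -⟩ := rank_eq_zero_and_torsionBy_eq_bot_and_sha_inf_torsionBy_eq_bot_of_natCard_selmerGroup_eq_one
    (W.quadraticTwist (NumberField.discr K : ℚ)) 2 hSelT
  have hrk : 1 ≤ W.mordellWeilRank := by
    have hsum := W.mordellWeilRank_baseChange_of_finrank_eq_two_of_finite K hK.1
    rw [hrkT0, add_zero] at hsum
    rw [← hsum]
    exact hK1
  obtain ⟨-, hT2, -⟩ := rank_eq_one_and_sha_primary_eq_zero_of_natCard_selmerGroup_eq_two W hSel hrk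
  exact fun P hP ↦ by convert hT2 P (by convert hP)

omit [W.IsGloballyMinimal] in
/-- `w(E) = −1` from `r_an(E) = 1` (parity at the conductor level for the newform of `Dt`). [cite: SilvermanAEC2009, C.16 (p. 451)] -/
theorem rootNumber_eq_neg_one_of_analyticRank_eq_one [NeZero (W.conductorNorm ℤ)] (hr : W.analyticRank = 1)
    (Dt : ModularParametrizationData W (W.conductorNorm ℤ)) : W.rootNumber = -1 := by
  rcases rootNumber_eq_one_or_eq_neg_one W with h | h
  · exfalso
    have hev := (Literature.Barriers.BirchSwinnertonDyer.even_analyticRank_iff_of_isNewformOf_conductorLevel Dt.isNewformOf).mpr h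
    rw [hr] at hev
    exact Nat.not_even_one hev
  · exact h

end Summit.BirchSwinnertonDyer.BirchSwinnertonDyer.Theorems.GenusExact.TwinSwapBit

end
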